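import Summits.CriticalPhenomena.PercolationContinuityZ3.Theorems.Transplant.SkelNegBParamsFaceFloorsY2SA
import Summits.CriticalPhenomena.PercolationContinuityZ3.Theorems.Transplant.SkelNegBParamsFaceFloorsY2TA
import Summits.CriticalPhenomena.PercolationContinuityZ3.Theorems.Transplant.SkelNegBParamsFaceBandRoomA
import Summits.CriticalPhenomena.PercolationContinuityZ3.Theorems.Transplant.SkelNegBParamsFaceBandA2
import Summits.CriticalPhenomena.PercolationContinuityZ3.Theorems.Transplant.SkelNegBParamsSlotsTA
import Summits.CriticalPhenomena.PercolationContinuityZ3.Theorems.Transplant.SkelNegBParamsResidualsA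
import HarnessLib

/-!
# N1 (the `{±1}` node), (F) column, M3 — **THE y′-FACE ASSEMBLY AT THE (ζ′) SLOT VALUES, PARAMETER HYPOTHESES DISCHARGED** (the y′ twin of p3-g12's X2HA):
# at `mk := 0`, `g := KS.gT 0 (KS.gxA c)`, `f := KS.fT 0 KS.fxA`, band `E := KS.RlevA κ Φ t p D 0 + KS.reachA t D 0`, transverse offset
# `kE := (prFA …).kFF₂ (fcellsA …) (E − 1) 1` (the y′ face's transverse axis is `0 = oth 1`):
# * **`floorsY2_hyps_A`** — the thirteen standard hypotheses of `KS.floorsY2_YFs/YFd/YFt` (Y2SA/Y2TA): `hnA` (`nL_floorsA`), `hℓA` (`ML_floorsA.1` + `EqNumL.ℓ_le`),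
#   `hS`/`hS64` (`ML_floorsA`), `hs0`/`hs1` (`cells_geTA'`), `hkF0/hkF1` (`kFA_le`), `hEu : E ≤ u₁A`, `hE2 : E ≤ 2RA′` (`RA'_eq`, `T₀a_lt_RA'`), and the band rooms at
#   `Rl := E − 1 ≤ 2RA′` (`apronRl_le`): `hkE : kE ≤ 5r₀`, `hkE8` (`hkE8_RA₂ … 1`), `hkE24` (`hkE24_RA₂ … 1`, FTYA) — `oth 1 = 0` is `rfl`;
# * **`floorsY2_YFs_A / floorsY2_YFd_A / floorsY2_YFt_A (c)`** — `Skelφ.FloorsY2` at the slot values with only the per-contact premises, the hop side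
#   `σh` (+ the (L-F1) convention `hhopLo/hhopHi`), the bridge-offset index `hc : NrY + 1 ≤ c`, the case premises and the r-floor `hr` left;
# * the canonical hop side `σh du := if 0 ≤ v_L then sgOf du else −sgOf du` (inline, no definition; `hopY_facts`) and the glue-binder forms
#   **`floorsY_YFs_A / floorsY_YFd_A / floorsY_YFt_A (c) (hc : 600·Kq ≤ c)`**: `∀ x du j z, du.1 = 1 → j < K → faceL du.1 j − E ≤ lev → lev ≤ faceL du.1 j + E →
#   |z (oth du.1) − cen x (oth du.1)| ≤ kFF₂ … (E − 1) du.1 → FloorsY2 … (σh du) (KS.BF? … (σh du)) (RA′ 0) (qBF c 0 g f) (RA′ 0) (qB3YA g f (RA′ 0)) (yLF? … (sgOf du) (σh du))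
#   (NrY …) (N3Y …) (σTY …)` — exactly hp-8's `floorsY` binder of `NegB.faceOblRM_negBTC₄?` (F-GLUE-CONSUMER-SHAPE.md §3) with the choice functions
#   `σhF := σh`, `qB′ := qBF c 0 g f`, `qB₃′ := qB3YA g f (RA′ 0)`, `yLF′ x du j z := yLF? … (sgOf du) (σh du)`; at v3 the glue reads them pointwise at `c := cK κ`
#   (`600·Kq ≤ cK κ`; `KS.gT 0 KS.gxAK κ … = KS.gT 0 (KS.gxA (cK κ)) κ …` by `KS.gT_gxAK`).
# (stmt-g17 2026-08-22; pen per lead (g9) 11:14Z.)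
builds on p205010 (kernel theorem, internal audit signed; external expert review pending) — nothing in this file uses p205010; NOTHING is claimed about
the open node `SamePDropOfSkeletonNeg₁`: this is the y′-face half of the (F) glue's `FloorsS/FloorsD/FloorsT` packages.
Lane `prim-bschramm-*`, seat `prim-bschramm-stmt` (gen 17); helper file (`--supports stmt-CriticalPhenomena-4575 --as helper`).
[cite: KozmaNitzan2024, §4 Lemma 11–12 (pp. 21–25), p. 28 ((32))] [cite: MartineauTassion2017, §4.3]
-/

noncomputable section

open scoped Classical

namespace Summit.CriticalPhenomena.PercolationContinuityZ3.Theorems.Transplant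

namespace PlanarSkeletonNeg

namespace NegB

open Literature.Probability.Percolation Literature.Probability.LatticeModels SimpleGraph KNCells KNLevels
open Literature.Probability.Percolation.KozmaNitzan.Cells (oth sgOf sgOf_sign stepVec_apply_fst)
open SkelConc (Consts)
open Skelφ (shearUnit shearUnit_pos)
open Skelφ.StepI (DataN)
open ChainPlanar (BridgePrm)
open TwoAxis.Para (modulus)
open Neg

namespace KS

variable (κ : Consts) {V : Type} [DecidableEq V] [Countable V] {G : SimpleGraph V} [G.LocallyFinite] (Φ : PlanarSkeletonNeg G) (t : V)
  (p : unitInterval) (D : DataN V) (c : ℕ)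

/-- **The thirteen standard hypotheses of the y′-face assembly at the (ζ′) slot values** (`mk := 0`, `g := gT 0 (gxA c)`, `f := fT 0 fxA`,
`E := RlevA + reachA`, `kE := kFF₂ … (E − 1) 1`). [folklore] -/
theorem floorsY2_hyps_A (hN : EqNumL κ Φ t p D (gT 0 (gxA c) κ Φ t p D) (fT 0 fxA κ Φ t p D)) (hκ : (hL κ Φ t p D (gT 0 (gxA c) κ Φ t p D) (fT 0 fxA κ Φ t p D)).natAbs ≤ 10 * nL κ Φ t p D (gT 0 (gxA c) κ Φ t p D) (fT 0 fxA κ Φ t p D)) :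
    2000 * Neg.Kq κ * (RA' κ Φ t p D 0 + 2) ≤ nL κ Φ t p D (gT 0 (gxA c) κ Φ t p D) (fT 0 fxA κ Φ t p D) ∧
    22000 * Neg.Kq κ * (RA' κ Φ t p D 0 + 2) ≤ ℓL κ Φ t p D (gT 0 (gxA c) κ Φ t p D) (fT 0 fxA κ Φ t p D) ∧
    16 * SF κ Φ t p D c 0 ≤ ML κ Φ t p D (gT 0 (gxA c) κ Φ t p D) ∧ 64 * SF κ Φ t p D c 0 ≤ ML κ Φ t p D (gT 0 (gxA c) κ Φ t p D) ∧
    6 * (RA' κ Φ t p D 0 : ℤ) + 11 ≤ u₀A κ Φ t p D (gT 0 (gxA c) κ Φ t p D) (fT 0 fxA κ Φ t p D) ∧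
    6 * (RA' κ Φ t p D 0 : ℤ) + 11 ≤ u₁A κ Φ t p D (gT 0 (gxA c) κ Φ t p D) (fT 0 fxA κ Φ t p D) ∧
    kF₀A κ Φ t p D c 0 (gT 0 (gxA c) κ Φ t p D) (fT 0 fxA κ Φ t p D) ≤ 8 * u₀A κ Φ t p D (gT 0 (gxA c) κ Φ t p D) (fT 0 fxA κ Φ t p D) + 1 ∧
    kF₁A κ Φ t p D c 0 (gT 0 (gxA c) κ Φ t p D) (fT 0 fxA κ Φ t p D) ≤ 8 * u₁A κ Φ t p D (gT 0 (gxA c) κ Φ t p D) (fT 0 fxA κ Φ t p D) + 1 ∧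
    (((RlevA κ Φ t p D 0 + reachA t D 0) : ℕ) : ℤ) ≤ u₁A κ Φ t p D (gT 0 (gxA c) κ Φ t p D) (fT 0 fxA κ Φ t p D) ∧
    (((RlevA κ Φ t p D 0 + reachA t D 0) : ℕ) : ℤ) ≤ 2 * (RA' κ Φ t p D 0 : ℤ) ∧
    ((prFA κ Φ t p D (gT 0 (gxA c) κ Φ t p D) (fT 0 fxA κ Φ t p D)).kFF₂ (fcellsA κ Φ t p D (gT 0 (gxA c) κ Φ t p D) (fT 0 fxA κ Φ t p D)) ((RlevA κ Φ t p D 0 + reachA t D 0) - 1) 1) ≤ 5 * ((fcellsA κ Φ t p D (gT 0 (gxA c) κ Φ t p D) (fT 0 fxA κ Φ t p D)).r 0 : ℤ) ∧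
    ((prFA κ Φ t p D (gT 0 (gxA c) κ Φ t p D) (fT 0 fxA κ Φ t p D)).kFF₂ (fcellsA κ Φ t p D (gT 0 (gxA c) κ Φ t p D) (fT 0 fxA κ Φ t p D)) ((RlevA κ Φ t p D 0 + reachA t D 0) - 1) 1) + 8 * u₀A κ Φ t p D (gT 0 (gxA c) κ Φ t p D) (fT 0 fxA κ Φ t p D) + 8 ≤ 5 * ((fcellsA κ Φ t p D (gT 0 (gxA c) κ Φ t p D) (fT 0 fxA κ Φ t p D)).r 0 : ℤ) ∧
    2 * ((prFA κ Φ t p D (gT 0 (gxA c) κ Φ t p D) (fT 0 fxA κ Φ t p D)).kFF₂ (fcellsA κ Φ t p D (gT 0 (gxA c) κ Φ t p D) (fT 0 fxA κ Φ t p D)) ((RlevA κ Φ t p D 0 + reachA t D 0) - 1) 1) + 24 * u₀A κ Φ t p D (gT 0 (gxA c) κ Φ t p D) (fT 0 fxA κ Φ t p D) + 24 ≤ 5 * ((fcellsA κ Φ t p D (gT 0 (gxA c) κ Φ t p D) (fT 0 fxA κ Φ t p D)).r 0 : ℤ) := by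
  have hML := ML_floorsA κ Φ t p D c
  have hnL := (nL_floorsA κ Φ t p D (gT 0 (gxA c) κ Φ t p D)).1
  have hnA : 2000 * Neg.Kq κ * (RA' κ Φ t p D 0 + 2) ≤ nL κ Φ t p D (gT 0 (gxA c) κ Φ t p D) (fT 0 fxA κ Φ t p D) :=
    le_trans (Nat.mul_le_mul_right _ (Nat.mul_le_mul_right _ (by norm_num))) hnL
  have hℓA : 22000 * Neg.Kq κ * (RA' κ Φ t p D 0 + 2) ≤ ℓL κ Φ t p D (gT 0 (gxA c) κ Φ t p D) (fT 0 fxA κ Φ t p D) := by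
    have h1 := hML.1
    have h2 := hN.ℓ_le
    have h3 : ML κ Φ t p D (gT 0 (gxA c) κ Φ t p D) ≤ ℓL κ Φ t p D (gT 0 (gxA c) κ Φ t p D) (fT 0 fxA κ Φ t p D) := by omega
    exact le_trans (le_trans (Nat.mul_le_mul_right _ (Nat.mul_le_mul_right _ (by norm_num))) h1) h3
  have hS := hML.2.2.2.1
  have hS64 := hML.2.2.1
  obtain ⟨hs0, -⟩ := cells_geTA' κ Φ t p D 0 (gxA c) (fT 0 fxA κ Φ t p D) hN hκ
  obtain ⟨-, hs1, -⟩ := uA_oth_facts κ Φ t p D (fT 0 fxA κ Φ t p D) 0 (gxA c) hN hκ (0 : Fin 2)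
  rw [show oth (0 : Fin 2) = 1 from rfl, if_neg (show ¬((1 : Fin 2) = 0) by decide)] at hs1
  obtain ⟨hkF0, hkF1⟩ := kFA_le κ Φ t p D c 0 (gxA c) (fT 0 fxA κ Φ t p D) hN hκ hS
  have hRA := RA'_eq κ Φ t p D 0
  have hre := (T₀a_lt_RA' κ Φ t p D 0).2.2.1
  have hE2 : (((RlevA κ Φ t p D 0 + reachA t D 0) : ℕ) : ℤ) ≤ 2 * (RA' κ Φ t p D 0 : ℤ) := by exact_mod_cast (by omega : (RlevA κ Φ t p D 0 + reachA t D 0) ≤ 2 * RA' κ Φ t p D 0)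
  have hR0 : (0 : ℤ) ≤ (RA' κ Φ t p D 0 : ℤ) := by positivity
  have hEu : (((RlevA κ Φ t p D 0 + reachA t D 0) : ℕ) : ℤ) ≤ u₁A κ Φ t p D (gT 0 (gxA c) κ Φ t p D) (fT 0 fxA κ Φ t p D) := by linarith
  have hRl := apronRl_le κ Φ t p D 0
  have h8 := hkE8_RA₂ κ Φ t p D (fT 0 fxA κ Φ t p D) 0 (gxA c) hN hκ hRl (1 : Fin 2)
  have h24 := hkE24_RA₂ κ Φ t p D (fT 0 fxA κ Φ t p D) 0 (gxA c) hN hκ hRl (1 : Fin 2)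
  rw [show oth (1 : Fin 2) = 0 from rfl, if_pos (show ((0 : Fin 2) = 0) from rfl)] at h8 h24
  have hu0 : 1 ≤ u₀A κ Φ t p D (gT 0 (gxA c) κ Φ t p D) (fT 0 fxA κ Φ t p D) := (units_eqA κ Φ t p D (gT 0 (gxA c) κ Φ t p D) (fT 0 fxA κ Φ t p D)).2.2.2.2.2.2.1
  exact ⟨hnA, hℓA, hS, hS64, hs0, hs1, by exact_mod_cast hkF0, by exact_mod_cast hkF1, hEu, hE2, by linarith, h8, h24⟩

/-- **The canonical hop side of the y′ face** (the (L-F1) convention) `σh := sgOf du` if `0 ≤ v_L`, else `−sgOf du` (written inline, no definition):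
it is `±1`, and `sgOf du·σh = 1 → 0 ≤ v_L`, `sgOf du·σh = −1 → v_L ≤ 0`. [folklore] -/
theorem hopY_facts (g f : ℕ) (du : MDir) :
    ((if 0 ≤ vL κ Φ t p D g f then sgOf du else -sgOf du) = 1 ∨ (if 0 ≤ vL κ Φ t p D g f then sgOf du else -sgOf du) = -1) ∧
      (sgOf du * (if 0 ≤ vL κ Φ t p D g f then sgOf du else -sgOf du) = 1 → 0 ≤ vL κ Φ t p D g f) ∧
      (sgOf du * (if 0 ≤ vL κ Φ t p D g f then sgOf du else -sgOf du) = -1 → vL κ Φ t p D g f ≤ 0) := by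
  have hσ : sgOf du = 1 ∨ sgOf du = -1 := sgOf_sign du
  split_ifs with hv
  · refine ⟨hσ, fun _ => hv, fun h => ?_⟩
    rcases hσ with e | e <;> rw [e] at h <;> norm_num at h
  · refine ⟨by rcases hσ with e | e <;> simp [e], fun h => ?_, fun _ => le_of_lt (lt_of_not_ge hv)⟩
    rcases hσ with e | e <;> rw [e] at h <;> norm_num at h


set_option maxHeartbeats 4000000 in
/-- **M3, y′-face, bridge case `s`: `Skelφ.FloorsY2` at the (ζ′) slot values, parameter hypotheses discharged** (`KS.floorsY2_YFs` ∘ `KS.floorsY2_hyps_A`).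
[cite: KozmaNitzan2024, §4 Lemma 11–12 (pp. 21–25)] -/
theorem floorsY2_YFs_A (c : ℕ)
    (hN : EqNumL κ Φ t p D (gT 0 (gxA c) κ Φ t p D) (fT 0 fxA κ Φ t p D)) (hκ : (hL κ Φ t p D (gT 0 (gxA c) κ Φ t p D) (fT 0 fxA κ Φ t p D)).natAbs ≤ 10 * nL κ Φ t p D (gT 0 (gxA c) κ Φ t p D) (fT 0 fxA κ Φ t p D))
    (x : Site 2) (du : MDir) (hd : du.1 = 1) (j : ℕ) (hj : j < (fcellsA κ Φ t p D (gT 0 (gxA c) κ Φ t p D) (fT 0 fxA κ Φ t p D)).K) (z : Site 2)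
    (hlev1 : (fcellsA κ Φ t p D (gT 0 (gxA c) κ Φ t p D) (fT 0 fxA κ Φ t p D)).faceL 1 j - (((RlevA κ Φ t p D 0 + reachA t D 0) : ℕ) : ℤ) ≤ (fcellsA κ Φ t p D (gT 0 (gxA c) κ Φ t p D) (fT 0 fxA κ Φ t p D)).lev du x z)
    (hlev2 : (fcellsA κ Φ t p D (gT 0 (gxA c) κ Φ t p D) (fT 0 fxA κ Φ t p D)).lev du x z ≤ (fcellsA κ Φ t p D (gT 0 (gxA c) κ Φ t p D) (fT 0 fxA κ Φ t p D)).faceL 1 j + (((RlevA κ Φ t p D 0 + reachA t D 0) : ℕ) : ℤ))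
    (hz : |z 0 - (fcellsA κ Φ t p D (gT 0 (gxA c) κ Φ t p D) (fT 0 fxA κ Φ t p D)).cen x 0| ≤ ((prFA κ Φ t p D (gT 0 (gxA c) κ Φ t p D) (fT 0 fxA κ Φ t p D)).kFF₂ (fcellsA κ Φ t p D (gT 0 (gxA c) κ Φ t p D) (fT 0 fxA κ Φ t p D)) ((RlevA κ Φ t p D 0 + reachA t D 0) - 1) 1))
    (σh : ℤ) (hσh : σh = 1 ∨ σh = -1) (hhopLo : sgOf du * σh = 1 → 0 ≤ vL κ Φ t p D (gT 0 (gxA c) κ Φ t p D) (fT 0 fxA κ Φ t p D)) (hhopHi : sgOf du * σh = -1 → vL κ Φ t p D (gT 0 (gxA c) κ Φ t p D) (fT 0 fxA κ Φ t p D) ≤ 0)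
    (hc : NrY κ Φ t p D (gT 0 (gxA c) κ Φ t p D) (fT 0 fxA κ Φ t p D) (yLFs κ Φ t p D c 0 (gT 0 (gxA c) κ Φ t p D) (fT 0 fxA κ Φ t p D) (sgOf du) σh) x du z + 1 ≤ c)
    (r : ℕ) (hr : ∀ X : ℕ, X + 1 ≤ exA κ Φ t p D (gT 0 (gxA c) κ Φ t p D) (fT 0 fxA κ Φ t p D) → X ≤ r) :
    Skelφ.FloorsY2 (prFA κ Φ t p D (gT 0 (gxA c) κ Φ t p D) (fT 0 fxA κ Φ t p D)) (nL κ Φ t p D (gT 0 (gxA c) κ Φ t p D) (fT 0 fxA κ Φ t p D)) (u₀A κ Φ t p D (gT 0 (gxA c) κ Φ t p D) (fT 0 fxA κ Φ t p D)) (u₁A κ Φ t p D (gT 0 (gxA c) κ Φ t p D) (fT 0 fxA κ Φ t p D))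
      (modulus (nL κ Φ t p D (gT 0 (gxA c) κ Φ t p D) (fT 0 fxA κ Φ t p D)) (hL κ Φ t p D (gT 0 (gxA c) κ Φ t p D) (fT 0 fxA κ Φ t p D)) (vL κ Φ t p D (gT 0 (gxA c) κ Φ t p D) (fT 0 fxA κ Φ t p D)) (vβL κ Φ t p D (gT 0 (gxA c) κ Φ t p D) (fT 0 fxA κ Φ t p D))) (nL κ Φ t p D (gT 0 (gxA c) κ Φ t p D) (fT 0 fxA κ Φ t p D) : ℤ) (ℓL κ Φ t p D (gT 0 (gxA c) κ Φ t p D) (fT 0 fxA κ Φ t p D))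
      (fcellsA κ Φ t p D (gT 0 (gxA c) κ Φ t p D) (fT 0 fxA κ Φ t p D)) (b0TA κ Φ t p D (gT 0 (gxA c) κ Φ t p D) (fT 0 fxA κ Φ t p D)) x du j 3 r (Mu D) z
      (fun i => if i = 0 then kF₀A κ Φ t p D c 0 (gT 0 (gxA c) κ Φ t p D) (fT 0 fxA κ Φ t p D) else kF₁A κ Φ t p D c 0 (gT 0 (gxA c) κ Φ t p D) (fT 0 fxA κ Φ t p D))
      σh (BFs κ Φ t p D c 0 (gT 0 (gxA c) κ Φ t p D) (fT 0 fxA κ Φ t p D) σh) (RA' κ Φ t p D 0) (qBF κ Φ t p D c 0 (gT 0 (gxA c) κ Φ t p D) (fT 0 fxA κ Φ t p D)) (RA' κ Φ t p D 0) (qB3YA κ Φ t p D (gT 0 (gxA c) κ Φ t p D) (fT 0 fxA κ Φ t p D) (RA' κ Φ t p D 0))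
      (yLFs κ Φ t p D c 0 (gT 0 (gxA c) κ Φ t p D) (fT 0 fxA κ Φ t p D) (sgOf du) σh) (NrY κ Φ t p D (gT 0 (gxA c) κ Φ t p D) (fT 0 fxA κ Φ t p D) (yLFs κ Φ t p D c 0 (gT 0 (gxA c) κ Φ t p D) (fT 0 fxA κ Φ t p D) (sgOf du) σh) x du z) (N3Y κ Φ t p D (gT 0 (gxA c) κ Φ t p D) (fT 0 fxA κ Φ t p D) (yLFs κ Φ t p D c 0 (gT 0 (gxA c) κ Φ t p D) (fT 0 fxA κ Φ t p D) (sgOf du) σh) x z) (σTY κ Φ t p D (gT 0 (gxA c) κ Φ t p D) (fT 0 fxA κ Φ t p D) (yLFs κ Φ t p D c 0 (gT 0 (gxA c) κ Φ t p D) (fT 0 fxA κ Φ t p D) (sgOf du) σh) x z) := by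
  obtain ⟨hnA, hℓA, hS, hS64, hs0, hs1, hkF0, hkF1, hEu, hE2, hkE, hkE8, hkE24⟩ := floorsY2_hyps_A κ Φ t p D c hN hκ
  exact floorsY2_YFs κ Φ t p D c 0 (gxA c) fxA hN hκ hnA hℓA hS hS64 hs0 hs1 hkF0 hkF1 x du hd j hj z hlev1 hlev2 hz hEu hE2 hkE hkE8 hkE24 σh hσh hhopLo hhopHi hc r hr

set_option maxHeartbeats 4000000 in
/-- **The y′-face floors in the (F) glue's binder shape, bridge case `s`** (`du.1`, `oth du.1`, `kFF₂ … du.1` as the provider layer binds them; hop side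
`if 0 ≤ v_L then sgOf du else −sgOf du`; bridge-offset index from `600·Kq ≤ c`). [cite: KozmaNitzan2024, §4 Lemma 11–12 (pp. 21–25)] -/
theorem floorsY_YFs_A (c : ℕ) (hN : EqNumL κ Φ t p D (gT 0 (gxA c) κ Φ t p D) (fT 0 fxA κ Φ t p D)) (hκ : (hL κ Φ t p D (gT 0 (gxA c) κ Φ t p D) (fT 0 fxA κ Φ t p D)).natAbs ≤ 10 * nL κ Φ t p D (gT 0 (gxA c) κ Φ t p D) (fT 0 fxA κ Φ t p D)) (hc : 600 * Neg.Kq κ ≤ c)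
    (r : ℕ) (hr : ∀ X : ℕ, X + 1 ≤ exA κ Φ t p D (gT 0 (gxA c) κ Φ t p D) (fT 0 fxA κ Φ t p D) → X ≤ r) :
    ∀ (x : Site 2) (du : MDir) (j : ℕ) (z : Site 2), du.1 = 1 → j < (fcellsA κ Φ t p D (gT 0 (gxA c) κ Φ t p D) (fT 0 fxA κ Φ t p D)).K →
      ((fcellsA κ Φ t p D (gT 0 (gxA c) κ Φ t p D) (fT 0 fxA κ Φ t p D)).faceL du.1 j : ℤ) - (((RlevA κ Φ t p D 0 + reachA t D 0) : ℕ) : ℤ) ≤ (fcellsA κ Φ t p D (gT 0 (gxA c) κ Φ t p D) (fT 0 fxA κ Φ t p D)).lev du x z →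
      (fcellsA κ Φ t p D (gT 0 (gxA c) κ Φ t p D) (fT 0 fxA κ Φ t p D)).lev du x z ≤ (fcellsA κ Φ t p D (gT 0 (gxA c) κ Φ t p D) (fT 0 fxA κ Φ t p D)).faceL du.1 j + (((RlevA κ Φ t p D 0 + reachA t D 0) : ℕ) : ℤ) →
      |z (oth du.1) - (fcellsA κ Φ t p D (gT 0 (gxA c) κ Φ t p D) (fT 0 fxA κ Φ t p D)).cen x (oth du.1)| ≤ (prFA κ Φ t p D (gT 0 (gxA c) κ Φ t p D) (fT 0 fxA κ Φ t p D)).kFF₂ (fcellsA κ Φ t p D (gT 0 (gxA c) κ Φ t p D) (fT 0 fxA κ Φ t p D)) ((RlevA κ Φ t p D 0 + reachA t D 0) - 1) du.1 →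
    Skelφ.FloorsY2 (prFA κ Φ t p D (gT 0 (gxA c) κ Φ t p D) (fT 0 fxA κ Φ t p D)) (nL κ Φ t p D (gT 0 (gxA c) κ Φ t p D) (fT 0 fxA κ Φ t p D)) (u₀A κ Φ t p D (gT 0 (gxA c) κ Φ t p D) (fT 0 fxA κ Φ t p D)) (u₁A κ Φ t p D (gT 0 (gxA c) κ Φ t p D) (fT 0 fxA κ Φ t p D))
      (modulus (nL κ Φ t p D (gT 0 (gxA c) κ Φ t p D) (fT 0 fxA κ Φ t p D)) (hL κ Φ t p D (gT 0 (gxA c) κ Φ t p D) (fT 0 fxA κ Φ t p D)) (vL κ Φ t p D (gT 0 (gxA c) κ Φ t p D) (fT 0 fxA κ Φ t p D)) (vβL κ Φ t p D (gT 0 (gxA c) κ Φ t p D) (fT 0 fxA κ Φ t p D))) (nL κ Φ t p D (gT 0 (gxA c) κ Φ t p D) (fT 0 fxA κ Φ t p D) : ℤ) (ℓL κ Φ t p D (gT 0 (gxA c) κ Φ t p D) (fT 0 fxA κ Φ t p D))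
      (fcellsA κ Φ t p D (gT 0 (gxA c) κ Φ t p D) (fT 0 fxA κ Φ t p D)) (b0TA κ Φ t p D (gT 0 (gxA c) κ Φ t p D) (fT 0 fxA κ Φ t p D)) x du j 3 r (Mu D) z
      (fun i => if i = 0 then kF₀A κ Φ t p D c 0 (gT 0 (gxA c) κ Φ t p D) (fT 0 fxA κ Φ t p D) else kF₁A κ Φ t p D c 0 (gT 0 (gxA c) κ Φ t p D) (fT 0 fxA κ Φ t p D))
      (if 0 ≤ vL κ Φ t p D (gT 0 (gxA c) κ Φ t p D) (fT 0 fxA κ Φ t p D) then sgOf du else -sgOf du) (BFs κ Φ t p D c 0 (gT 0 (gxA c) κ Φ t p D) (fT 0 fxA κ Φ t p D) (if 0 ≤ vL κ Φ t p D (gT 0 (gxA c) κ Φ t p D) (fT 0 fxA κ Φ t p D) then sgOf du else -sgOf du)) (RA' κ Φ t p D 0) (qBF κ Φ t p D c 0 (gT 0 (gxA c) κ Φ t p D) (fT 0 fxA κ Φ t p D)) (RA' κ Φ t p D 0) (qB3YA κ Φ t p D (gT 0 (gxA c) κ Φ t p D) (fT 0 fxA κ Φ t p D) (RA' κ Φ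 t p D 0))
      (yLFs κ Φ t p D c 0 (gT 0 (gxA c) κ Φ t p D) (fT 0 fxA κ Φ t p D) (sgOf du) (if 0 ≤ vL κ Φ t p D (gT 0 (gxA c) κ Φ t p D) (fT 0 fxA κ Φ t p D) then sgOf du else -sgOf du)) (NrY κ Φ t p D (gT 0 (gxA c) κ Φ t p D) (fT 0 fxA κ Φ t p D) (yLFs κ Φ t p D c 0 (gT 0 (gxA c) κ Φ t p D) (fT 0 fxA κ Φ t p D) (sgOf du) (if 0 ≤ vL κ Φ t p D (gT 0 (gxA c) κ Φ t p D) (fT 0 fxA κ Φ t p D) then sgOf du else -sgOf du)) x du z) (N3Y κ Φ t p D (gT 0 (gxA c) κ Φ t p D) (fT 0 fxA κ Φ t p D) (yLFs κ Φ t p D c 0 (gT 0 (gxA c) κ Φ t p D) (fT 0 fxA κ Φ t p D) (sgOf du) (if 0 ≤ vL κ Φ t p D (gT 0 (gxA c) κ Φ t p D) (fT 0 fxA κ Φ t p D) then sgOf du else -sgOf du)) x z) (σTY κ Φ t p D (gT 0 (gxA c) κ Φ t p D) (fT 0 fxA κ Φ t p D) (yLFs κ Φ t p D c 0 (gT 0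 (gxA c) κ Φ t p D) (fT 0 fxA κ Φ t p D) (sgOf du) (if 0 ≤ vL κ Φ t p D (gT 0 (gxA c) κ Φ t p D) (fT 0 fxA κ Φ t p D) then sgOf du else -sgOf du)) x z) := by
  intro x du j z hd hj hlev1 hlev2 hz
  obtain ⟨i, sδ⟩ := du
  change i = 1 at hd
  subst hd
  obtain ⟨hσh, hlo, hhi⟩ := hopY_facts κ Φ t p D (gT 0 (gxA c) κ Φ t p D) (fT 0 fxA κ Φ t p D) ((1 : Fin 2), sδ)
  obtain ⟨hnA, hℓA, hS, hS64, hs0, hs1, hkF0, hkF1, hEu, hE2, hkE, hkE8, hkE24⟩ := floorsY2_hyps_A κ Φ t p D c hN hκ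
  have hcN := (rangesY_YFs κ Φ t p D c 0 (gxA c) fxA hN hκ hS x ((1 : Fin 2), sδ) rfl j hj z hlev1 hlev2 hz hEu hkE _ hσh).1
  exact floorsY2_YFs_A κ Φ t p D c hN hκ x ((1 : Fin 2), sδ) rfl j hj z hlev1 hlev2 hz _ hσh hlo hhi (hcN.trans hc) r hr

set_option maxHeartbeats 4000000 in
/-- **M3, y′-face, bridge case `d`: `Skelφ.FloorsY2` at the (ζ′) slot values, parameter hypotheses discharged** (`KS.floorsY2_YFd` ∘ `KS.floorsY2_hyps_A`).
[cite: KozmaNitzan2024, §4 Lemma 11–12 (pp. 21–25)] -/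
theorem floorsY2_YFd_A (c : ℕ)
    (hN : EqNumL κ Φ t p D (gT 0 (gxA c) κ Φ t p D) (fT 0 fxA κ Φ t p D)) (hκ : (hL κ Φ t p D (gT 0 (gxA c) κ Φ t p D) (fT 0 fxA κ Φ t p D)).natAbs ≤ 10 * nL κ Φ t p D (gT 0 (gxA c) κ Φ t p D) (fT 0 fxA κ Φ t p D))
    (x : Site 2) (du : MDir) (hd : du.1 = 1) (j : ℕ) (hj : j < (fcellsA κ Φ t p D (gT 0 (gxA c) κ Φ t p D) (fT 0 fxA κ Φ t p D)).K) (z : Site 2)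
    (hlev1 : (fcellsA κ Φ t p D (gT 0 (gxA c) κ Φ t p D) (fT 0 fxA κ Φ t p D)).faceL 1 j - (((RlevA κ Φ t p D 0 + reachA t D 0) : ℕ) : ℤ) ≤ (fcellsA κ Φ t p D (gT 0 (gxA c) κ Φ t p D) (fT 0 fxA κ Φ t p D)).lev du x z)
    (hlev2 : (fcellsA κ Φ t p D (gT 0 (gxA c) κ Φ t p D) (fT 0 fxA κ Φ t p D)).lev du x z ≤ (fcellsA κ Φ t p D (gT 0 (gxA c) κ Φ t p D) (fT 0 fxA κ Φ t p D)).faceL 1 j + (((RlevA κ Φ t p D 0 + reachA t D 0) : ℕ) : ℤ))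
    (hz : |z 0 - (fcellsA κ Φ t p D (gT 0 (gxA c) κ Φ t p D) (fT 0 fxA κ Φ t p D)).cen x 0| ≤ ((prFA κ Φ t p D (gT 0 (gxA c) κ Φ t p D) (fT 0 fxA κ Φ t p D)).kFF₂ (fcellsA κ Φ t p D (gT 0 (gxA c) κ Φ t p D) (fT 0 fxA κ Φ t p D)) ((RlevA κ Φ t p D 0 + reachA t D 0) - 1) 1))
    (σh : ℤ) (hσh : σh = 1 ∨ σh = -1) (hhopLo : sgOf du * σh = 1 → 0 ≤ vL κ Φ t p D (gT 0 (gxA c) κ Φ t p D) (fT 0 fxA κ Φ t p D)) (hhopHi : sgOf du * σh = -1 → vL κ Φ t p D (gT 0 (gxA c) κ Φ t p D) (fT 0 fxA κ Φ t p D) ≤ 0)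
    (hc : NrY κ Φ t p D (gT 0 (gxA c) κ Φ t p D) (fT 0 fxA κ Φ t p D) (yLFd κ Φ t p D c 0 (gT 0 (gxA c) κ Φ t p D) (fT 0 fxA κ Φ t p D) (sgOf du) σh) x du z + 1 ≤ c)
    (hside : ℓBF κ Φ t p D c 0 < 2 * (hBF κ Φ t p D c 0).natAbs) (hℓb : 2 * bF κ Φ t p D c 0 + 27 ≤ ℓBF κ Φ t p D c 0)
    (r : ℕ) (hr : ∀ X : ℕ, X + 1 ≤ exA κ Φ t p D (gT 0 (gxA c) κ Φ t p D) (fT 0 fxA κ Φ t p D) → X ≤ r) :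
    Skelφ.FloorsY2 (prFA κ Φ t p D (gT 0 (gxA c) κ Φ t p D) (fT 0 fxA κ Φ t p D)) (nL κ Φ t p D (gT 0 (gxA c) κ Φ t p D) (fT 0 fxA κ Φ t p D)) (u₀A κ Φ t p D (gT 0 (gxA c) κ Φ t p D) (fT 0 fxA κ Φ t p D)) (u₁A κ Φ t p D (gT 0 (gxA c) κ Φ t p D) (fT 0 fxA κ Φ t p D))
      (modulus (nL κ Φ t p D (gT 0 (gxA c) κ Φ t p D) (fT 0 fxA κ Φ t p D)) (hL κ Φ t p D (gT 0 (gxA c) κ Φ t p D) (fT 0 fxA κ Φ t p D)) (vL κ Φ t p D (gT 0 (gxA c) κ Φ t p D) (fT 0 fxA κ Φ t p D)) (vβL κ Φ t p D (gT 0 (gxA c) κ Φ t p D) (fT 0 fxA κ Φ t p D))) (nL κ Φ t p D (gT 0 (gxA c) κ Φ t p D) (fT 0 fxA κ Φ t p D) : ℤ) (ℓL κ Φ t p D (gT 0 (gxA c) κ Φ t p D) (fT 0 fxA κ Φ t p D))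
      (fcellsA κ Φ t p D (gT 0 (gxA c) κ Φ t p D) (fT 0 fxA κ Φ t p D)) (b0TA κ Φ t p D (gT 0 (gxA c) κ Φ t p D) (fT 0 fxA κ Φ t p D)) x du j 3 r (Mu D) z
      (fun i => if i = 0 then kF₀A κ Φ t p D c 0 (gT 0 (gxA c) κ Φ t p D) (fT 0 fxA κ Φ t p D) else kF₁A κ Φ t p D c 0 (gT 0 (gxA c) κ Φ t p D) (fT 0 fxA κ Φ t p D))
      σh (BFd κ Φ t p D c 0 (gT 0 (gxA c) κ Φ t p D) (fT 0 fxA κ Φ t p D) σh) (RA' κ Φ t p D 0) (qBF κ Φ t p D c 0 (gT 0 (gxA c) κ Φ t p D) (fT 0 fxA κ Φ t p D)) (RA' κ Φ t p D 0) (qB3YA κ Φ t p D (gT 0 (gxA c) κ Φ t p D) (fT 0 fxA κ Φ t p D) (RA' κ Φ t p D 0))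
      (yLFd κ Φ t p D c 0 (gT 0 (gxA c) κ Φ t p D) (fT 0 fxA κ Φ t p D) (sgOf du) σh) (NrY κ Φ t p D (gT 0 (gxA c) κ Φ t p D) (fT 0 fxA κ Φ t p D) (yLFd κ Φ t p D c 0 (gT 0 (gxA c) κ Φ t p D) (fT 0 fxA κ Φ t p D) (sgOf du) σh) x du z) (N3Y κ Φ t p D (gT 0 (gxA c) κ Φ t p D) (fT 0 fxA κ Φ t p D) (yLFd κ Φ t p D c 0 (gT 0 (gxA c) κ Φ t p D) (fT 0 fxA κ Φ t p D) (sgOf du) σh) x z) (σTY κ Φ t p D (gT 0 (gxA c) κ Φ t p D) (fT 0 fxA κ Φ t p D) (yLFd κ Φ t p D c 0 (gT 0 (gxA c) κ Φ t p D) (fT 0 fxA κ Φ t p D) (sgOf du) σh) x z) := by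
  obtain ⟨hnA, hℓA, hS, hS64, hs0, hs1, hkF0, hkF1, hEu, hE2, hkE, hkE8, hkE24⟩ := floorsY2_hyps_A κ Φ t p D c hN hκ
  exact floorsY2_YFd κ Φ t p D c 0 (gxA c) fxA hN hκ hnA hℓA hS hS64 hs0 hs1 hkF0 hkF1 x du hd j hj z hlev1 hlev2 hz hEu hE2 hkE hkE8 hkE24 hside hℓb σh hσh hhopLo hhopHi hc r hr

set_option maxHeartbeats 4000000 in
/-- **The y′-face floors in the (F) glue's binder shape, bridge case `d`** (`du.1`, `oth du.1`, `kFF₂ … du.1` as the provider layer binds them; hop side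
`if 0 ≤ v_L then sgOf du else −sgOf du`; bridge-offset index from `600·Kq ≤ c`). [cite: KozmaNitzan2024, §4 Lemma 11–12 (pp. 21–25)] -/
theorem floorsY_YFd_A (c : ℕ) (hN : EqNumL κ Φ t p D (gT 0 (gxA c) κ Φ t p D) (fT 0 fxA κ Φ t p D)) (hκ : (hL κ Φ t p D (gT 0 (gxA c) κ Φ t p D) (fT 0 fxA κ Φ t p D)).natAbs ≤ 10 * nL κ Φ t p D (gT 0 (gxA c) κ Φ t p D) (fT 0 fxA κ Φ t p D)) (hc : 600 * Neg.Kq κ ≤ c)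
    (hside : ℓBF κ Φ t p D c 0 < 2 * (hBF κ Φ t p D c 0).natAbs) (hℓb : 2 * bF κ Φ t p D c 0 + 27 ≤ ℓBF κ Φ t p D c 0)
    (r : ℕ) (hr : ∀ X : ℕ, X + 1 ≤ exA κ Φ t p D (gT 0 (gxA c) κ Φ t p D) (fT 0 fxA κ Φ t p D) → X ≤ r) :
    ∀ (x : Site 2) (du : MDir) (j : ℕ) (z : Site 2), du.1 = 1 → j < (fcellsA κ Φ t p D (gT 0 (gxA c) κ Φ t p D) (fT 0 fxA κ Φ t p D)).K →
      ((fcellsA κ Φ t p D (gT 0 (gxA c) κ Φ t p D) (fT 0 fxA κ Φ t p D)).faceL du.1 j : ℤ) - (((RlevA κ Φ t p D 0 + reachA t D 0) : ℕ) : ℤ) ≤ (fcellsA κ Φ t p D (gT 0 (gxA c) κ Φ t p D) (fT 0 fxA κ Φ t p D)).lev du x z →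
      (fcellsA κ Φ t p D (gT 0 (gxA c) κ Φ t p D) (fT 0 fxA κ Φ t p D)).lev du x z ≤ (fcellsA κ Φ t p D (gT 0 (gxA c) κ Φ t p D) (fT 0 fxA κ Φ t p D)).faceL du.1 j + (((RlevA κ Φ t p D 0 + reachA t D 0) : ℕ) : ℤ) →
      |z (oth du.1) - (fcellsA κ Φ t p D (gT 0 (gxA c) κ Φ t p D) (fT 0 fxA κ Φ t p D)).cen x (oth du.1)| ≤ (prFA κ Φ t p D (gT 0 (gxA c) κ Φ t p D) (fT 0 fxA κ Φ t p D)).kFF₂ (fcellsA κ Φ t p D (gT 0 (gxA c) κ Φ t p D) (fT 0 fxA κ Φ t p D)) ((RlevA κ Φ t p D 0 + reachA t D 0) - 1) du.1 →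
    Skelφ.FloorsY2 (prFA κ Φ t p D (gT 0 (gxA c) κ Φ t p D) (fT 0 fxA κ Φ t p D)) (nL κ Φ t p D (gT 0 (gxA c) κ Φ t p D) (fT 0 fxA κ Φ t p D)) (u₀A κ Φ t p D (gT 0 (gxA c) κ Φ t p D) (fT 0 fxA κ Φ t p D)) (u₁A κ Φ t p D (gT 0 (gxA c) κ Φ t p D) (fT 0 fxA κ Φ t p D))
      (modulus (nL κ Φ t p D (gT 0 (gxA c) κ Φ t p D) (fT 0 fxA κ Φ t p D)) (hL κ Φ t p D (gT 0 (gxA c) κ Φ t p D) (fT 0 fxA κ Φ t p D)) (vL κ Φ t p D (gT 0 (gxA c) κ Φ t p D) (fT 0 fxA κ Φ t p D)) (vβL κ Φ t p D (gT 0 (gxA c) κ Φ t p D) (fT 0 fxA κ Φ t p D))) (nL κ Φ t p D (gT 0 (gxA c) κ Φ t p D) (fT 0 fxA κ Φ t p D) : ℤ) (ℓL κ Φ t p D (gT 0 (gxA c) κ Φ t p D) (fT 0 fxA κ Φ t p D))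
      (fcellsA κ Φ t p D (gT 0 (gxA c) κ Φ t p D) (fT 0 fxA κ Φ t p D)) (b0TA κ Φ t p D (gT 0 (gxA c) κ Φ t p D) (fT 0 fxA κ Φ t p D)) x du j 3 r (Mu D) z
      (fun i => if i = 0 then kF₀A κ Φ t p D c 0 (gT 0 (gxA c) κ Φ t p D) (fT 0 fxA κ Φ t p D) else kF₁A κ Φ t p D c 0 (gT 0 (gxA c) κ Φ t p D) (fT 0 fxA κ Φ t p D))
      (if 0 ≤ vL κ Φ t p D (gT 0 (gxA c) κ Φ t p D) (fT 0 fxA κ Φ t p D) then sgOf du else -sgOf du) (BFd κ Φ t p D c 0 (gT 0 (gxA c) κ Φ t p D) (fT 0 fxA κ Φ t p D) (if 0 ≤ vL κ Φ t p D (gT 0 (gxA c) κ Φ t p D) (fT 0 fxA κ Φ t p D) then sgOf du else -sgOf du)) (RA' κ Φ t p D 0) (qBF κ Φ t p D c 0 (gT 0 (gxA c) κ Φ t p D) (fT 0 fxA κ Φ t p D)) (RA' κ Φ t p D 0) (qB3YA κ Φ t p D (gT 0 (gxA c) κ Φ t p D) (fT 0 fxA κ Φ t p D) (RA' κ Φ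 t p D 0))
      (yLFd κ Φ t p D c 0 (gT 0 (gxA c) κ Φ t p D) (fT 0 fxA κ Φ t p D) (sgOf du) (if 0 ≤ vL κ Φ t p D (gT 0 (gxA c) κ Φ t p D) (fT 0 fxA κ Φ t p D) then sgOf du else -sgOf du)) (NrY κ Φ t p D (gT 0 (gxA c) κ Φ t p D) (fT 0 fxA κ Φ t p D) (yLFd κ Φ t p D c 0 (gT 0 (gxA c) κ Φ t p D) (fT 0 fxA κ Φ t p D) (sgOf du) (if 0 ≤ vL κ Φ t p D (gT 0 (gxA c) κ Φ t p D) (fT 0 fxA κ Φ t p D) then sgOf du else -sgOf du)) x du z) (N3Y κ Φ t p D (gT 0 (gxA c) κ Φ t p D) (fT 0 fxA κ Φ t p D) (yLFd κ Φ t p D c 0 (gT 0 (gxA c) κ Φ t p D) (fT 0 fxA κ Φ t p D) (sgOf du) (if 0 ≤ vL κ Φ t p D (gT 0 (gxA c) κ Φ t p D) (fT 0 fxA κ Φ t p D) then sgOf du else -sgOf du)) x z) (σTY κ Φ t p D (gT 0 (gxA c) κ Φ t p D) (fT 0 fxA κ Φ t p D) (yLFd κ Φ t p D c 0 (gT 0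 (gxA c) κ Φ t p D) (fT 0 fxA κ Φ t p D) (sgOf du) (if 0 ≤ vL κ Φ t p D (gT 0 (gxA c) κ Φ t p D) (fT 0 fxA κ Φ t p D) then sgOf du else -sgOf du)) x z) := by
  intro x du j z hd hj hlev1 hlev2 hz
  obtain ⟨i, sδ⟩ := du
  change i = 1 at hd
  subst hd
  obtain ⟨hσh, hlo, hhi⟩ := hopY_facts κ Φ t p D (gT 0 (gxA c) κ Φ t p D) (fT 0 fxA κ Φ t p D) ((1 : Fin 2), sδ)
  obtain ⟨hnA, hℓA, hS, hS64, hs0, hs1, hkF0, hkF1, hEu, hE2, hkE, hkE8, hkE24⟩ := floorsY2_hyps_A κ Φ t p D c hN hκ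
  have hcN := (rangesY_YFd κ Φ t p D c 0 (gxA c) fxA hN hκ hS x ((1 : Fin 2), sδ) rfl j hj z hlev1 hlev2 hz hEu hkE _ hσh).1
  exact floorsY2_YFd_A κ Φ t p D c hN hκ x ((1 : Fin 2), sδ) rfl j hj z hlev1 hlev2 hz _ hσh hlo hhi (hcN.trans hc) hside hℓb r hr

set_option maxHeartbeats 4000000 in
/-- **M3, y′-face, bridge case `t`: `Skelφ.FloorsY2` at the (ζ′) slot values, parameter hypotheses discharged** (`KS.floorsY2_YFt` ∘ `KS.floorsY2_hyps_A`).
[cite: KozmaNitzan2024, §4 Lemma 11–12 (pp. 21–25)] -/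
theorem floorsY2_YFt_A (c : ℕ)
    (hN : EqNumL κ Φ t p D (gT 0 (gxA c) κ Φ t p D) (fT 0 fxA κ Φ t p D)) (hκ : (hL κ Φ t p D (gT 0 (gxA c) κ Φ t p D) (fT 0 fxA κ Φ t p D)).natAbs ≤ 10 * nL κ Φ t p D (gT 0 (gxA c) κ Φ t p D) (fT 0 fxA κ Φ t p D))
    (x : Site 2) (du : MDir) (hd : du.1 = 1) (j : ℕ) (hj : j < (fcellsA κ Φ t p D (gT 0 (gxA c) κ Φ t p D) (fT 0 fxA κ Φ t p D)).K) (z : Site 2)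
    (hlev1 : (fcellsA κ Φ t p D (gT 0 (gxA c) κ Φ t p D) (fT 0 fxA κ Φ t p D)).faceL 1 j - (((RlevA κ Φ t p D 0 + reachA t D 0) : ℕ) : ℤ) ≤ (fcellsA κ Φ t p D (gT 0 (gxA c) κ Φ t p D) (fT 0 fxA κ Φ t p D)).lev du x z)
    (hlev2 : (fcellsA κ Φ t p D (gT 0 (gxA c) κ Φ t p D) (fT 0 fxA κ Φ t p D)).lev du x z ≤ (fcellsA κ Φ t p D (gT 0 (gxA c) κ Φ t p D) (fT 0 fxA κ Φ t p D)).faceL 1 j + (((RlevA κ Φ t p D 0 + reachA t D 0) : ℕ) : ℤ))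
    (hz : |z 0 - (fcellsA κ Φ t p D (gT 0 (gxA c) κ Φ t p D) (fT 0 fxA κ Φ t p D)).cen x 0| ≤ ((prFA κ Φ t p D (gT 0 (gxA c) κ Φ t p D) (fT 0 fxA κ Φ t p D)).kFF₂ (fcellsA κ Φ t p D (gT 0 (gxA c) κ Φ t p D) (fT 0 fxA κ Φ t p D)) ((RlevA κ Φ t p D 0 + reachA t D 0) - 1) 1))
    (σh : ℤ) (hσh : σh = 1 ∨ σh = -1) (hhopLo : sgOf du * σh = 1 → 0 ≤ vL κ Φ t p D (gT 0 (gxA c) κ Φ t p D) (fT 0 fxA κ Φ t p D)) (hhopHi : sgOf du * σh = -1 → vL κ Φ t p D (gT 0 (gxA c) κ Φ t p D) (fT 0 fxA κ Φ t p D) ≤ 0)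
    (hc : NrY κ Φ t p D (gT 0 (gxA c) κ Φ t p D) (fT 0 fxA κ Φ t p D) (yLFt κ Φ t p D c 0 (gT 0 (gxA c) κ Φ t p D) (fT 0 fxA κ Φ t p D) (sgOf du) σh) x du z + 1 ≤ c)
    (htop : 2 * (hBF κ Φ t p D c 0).natAbs ≤ ℓBF κ Φ t p D c 0) (hℓb : 2 * bF κ Φ t p D c 0 + 27 ≤ ℓBF κ Φ t p D c 0)
    (r : ℕ) (hr : ∀ X : ℕ, X + 1 ≤ exA κ Φ t p D (gT 0 (gxA c) κ Φ t p D) (fT 0 fxA κ Φ t p D) → X ≤ r) :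
    Skelφ.FloorsY2 (prFA κ Φ t p D (gT 0 (gxA c) κ Φ t p D) (fT 0 fxA κ Φ t p D)) (nL κ Φ t p D (gT 0 (gxA c) κ Φ t p D) (fT 0 fxA κ Φ t p D)) (u₀A κ Φ t p D (gT 0 (gxA c) κ Φ t p D) (fT 0 fxA κ Φ t p D)) (u₁A κ Φ t p D (gT 0 (gxA c) κ Φ t p D) (fT 0 fxA κ Φ t p D))
      (modulus (nL κ Φ t p D (gT 0 (gxA c) κ Φ t p D) (fT 0 fxA κ Φ t p D)) (hL κ Φ t p D (gT 0 (gxA c) κ Φ t p D) (fT 0 fxA κ Φ t p D)) (vL κ Φ t p D (gT 0 (gxA c) κ Φ t p D) (fT 0 fxA κ Φ t p D)) (vβL κ Φ t p D (gT 0 (gxA c) κ Φ t p D) (fT 0 fxA κ Φ t p D))) (nL κ Φ t p D (gT 0 (gxA c) κ Φ t p D) (fT 0 fxA κ Φ t p D) : ℤ) (ℓL κ Φ t p D (gT 0 (gxA c) κ Φ t p D) (fT 0 fxA κ Φ t p D))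
      (fcellsA κ Φ t p D (gT 0 (gxA c) κ Φ t p D) (fT 0 fxA κ Φ t p D)) (b0TA κ Φ t p D (gT 0 (gxA c) κ Φ t p D) (fT 0 fxA κ Φ t p D)) x du j 3 r (Mu D) z
      (fun i => if i = 0 then kF₀A κ Φ t p D c 0 (gT 0 (gxA c) κ Φ t p D) (fT 0 fxA κ Φ t p D) else kF₁A κ Φ t p D c 0 (gT 0 (gxA c) κ Φ t p D) (fT 0 fxA κ Φ t p D))
      σh (BFt κ Φ t p D c 0 (gT 0 (gxA c) κ Φ t p D) (fT 0 fxA κ Φ t p D) σh) (RA' κ Φ t p D 0) (qBF κ Φ t p D c 0 (gT 0 (gxA c) κ Φ t p D) (fT 0 fxA κ Φ t p D)) (RA' κ Φ t p D 0) (qB3YA κ Φ t p D (gT 0 (gxA c) κ Φ t p D) (fT 0 fxA κ Φ t p D) (RA' κ Φ t p D 0))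
      (yLFt κ Φ t p D c 0 (gT 0 (gxA c) κ Φ t p D) (fT 0 fxA κ Φ t p D) (sgOf du) σh) (NrY κ Φ t p D (gT 0 (gxA c) κ Φ t p D) (fT 0 fxA κ Φ t p D) (yLFt κ Φ t p D c 0 (gT 0 (gxA c) κ Φ t p D) (fT 0 fxA κ Φ t p D) (sgOf du) σh) x du z) (N3Y κ Φ t p D (gT 0 (gxA c) κ Φ t p D) (fT 0 fxA κ Φ t p D) (yLFt κ Φ t p D c 0 (gT 0 (gxA c) κ Φ t p D) (fT 0 fxA κ Φ t p D) (sgOf du) σh) x z) (σTY κ Φ t p D (gT 0 (gxA c) κ Φ t p D) (fT 0 fxA κ Φ t p D) (yLFt κ Φ t p D c 0 (gT 0 (gxA c) κ Φ t p D) (fT 0 fxA κ Φ t p D) (sgOf du) σh) x z) := by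
  obtain ⟨hnA, hℓA, hS, hS64, hs0, hs1, hkF0, hkF1, hEu, hE2, hkE, hkE8, hkE24⟩ := floorsY2_hyps_A κ Φ t p D c hN hκ
  exact floorsY2_YFt κ Φ t p D c 0 (gxA c) fxA hN hκ hnA hℓA hS hS64 hs0 hs1 hkF0 hkF1 x du hd j hj z hlev1 hlev2 hz hEu hE2 hkE hkE8 hkE24 htop hℓb σh hσh hhopLo hhopHi hc r hr

set_option maxHeartbeats 4000000 in
/-- **The y′-face floors in the (F) glue's binder shape, bridge case `t`** (`du.1`, `oth du.1`, `kFF₂ … du.1` as the provider layer binds them; hop side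
`if 0 ≤ v_L then sgOf du else −sgOf du`; bridge-offset index from `600·Kq ≤ c`). [cite: KozmaNitzan2024, §4 Lemma 11–12 (pp. 21–25)] -/
theorem floorsY_YFt_A (c : ℕ) (hN : EqNumL κ Φ t p D (gT 0 (gxA c) κ Φ t p D) (fT 0 fxA κ Φ t p D)) (hκ : (hL κ Φ t p D (gT 0 (gxA c) κ Φ t p D) (fT 0 fxA κ Φ t p D)).natAbs ≤ 10 * nL κ Φ t p D (gT 0 (gxA c) κ Φ t p D) (fT 0 fxA κ Φ t p D)) (hc : 600 * Neg.Kq κ ≤ c)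
    (htop : 2 * (hBF κ Φ t p D c 0).natAbs ≤ ℓBF κ Φ t p D c 0) (hℓb : 2 * bF κ Φ t p D c 0 + 27 ≤ ℓBF κ Φ t p D c 0)
    (r : ℕ) (hr : ∀ X : ℕ, X + 1 ≤ exA κ Φ t p D (gT 0 (gxA c) κ Φ t p D) (fT 0 fxA κ Φ t p D) → X ≤ r) :
    ∀ (x : Site 2) (du : MDir) (j : ℕ) (z : Site 2), du.1 = 1 → j < (fcellsA κ Φ t p D (gT 0 (gxA c) κ Φ t p D) (fT 0 fxA κ Φ t p D)).K →
      ((fcellsA κ Φ t p D (gT 0 (gxA c) κ Φ t p D) (fT 0 fxA κ Φ t p D)).faceL du.1 j : ℤ) - (((RlevA κ Φ t p D 0 + reachA t D 0) : ℕ) : ℤ) ≤ (fcellsA κ Φ t p D (gT 0 (gxA c) κ Φ t p D) (fT 0 fxA κ Φ t p D)).lev du x z →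
      (fcellsA κ Φ t p D (gT 0 (gxA c) κ Φ t p D) (fT 0 fxA κ Φ t p D)).lev du x z ≤ (fcellsA κ Φ t p D (gT 0 (gxA c) κ Φ t p D) (fT 0 fxA κ Φ t p D)).faceL du.1 j + (((RlevA κ Φ t p D 0 + reachA t D 0) : ℕ) : ℤ) →
      |z (oth du.1) - (fcellsA κ Φ t p D (gT 0 (gxA c) κ Φ t p D) (fT 0 fxA κ Φ t p D)).cen x (oth du.1)| ≤ (prFA κ Φ t p D (gT 0 (gxA c) κ Φ t p D) (fT 0 fxA κ Φ t p D)).kFF₂ (fcellsA κ Φ t p D (gT 0 (gxA c) κ Φ t p D) (fT 0 fxA κ Φ t p D)) ((RlevA κ Φ t p D 0 + reachA t D 0) - 1) du.1 →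
    Skelφ.FloorsY2 (prFA κ Φ t p D (gT 0 (gxA c) κ Φ t p D) (fT 0 fxA κ Φ t p D)) (nL κ Φ t p D (gT 0 (gxA c) κ Φ t p D) (fT 0 fxA κ Φ t p D)) (u₀A κ Φ t p D (gT 0 (gxA c) κ Φ t p D) (fT 0 fxA κ Φ t p D)) (u₁A κ Φ t p D (gT 0 (gxA c) κ Φ t p D) (fT 0 fxA κ Φ t p D))
      (modulus (nL κ Φ t p D (gT 0 (gxA c) κ Φ t p D) (fT 0 fxA κ Φ t p D)) (hL κ Φ t p D (gT 0 (gxA c) κ Φ t p D) (fT 0 fxA κ Φ t p D)) (vL κ Φ t p D (gT 0 (gxA c) κ Φ t p D) (fT 0 fxA κ Φ t p D)) (vβL κ Φ t p D (gT 0 (gxA c) κ Φ t p D) (fT 0 fxA κ Φ t p D))) (nL κ Φ t p D (gT 0 (gxA c) κ Φ t p D) (fT 0 fxA κ Φ t p D) : ℤ) (ℓL κ Φ t p D (gT 0 (gxA c) κ Φ t p D) (fT 0 fxA κ Φ t p D))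
      (fcellsA κ Φ t p D (gT 0 (gxA c) κ Φ t p D) (fT 0 fxA κ Φ t p D)) (b0TA κ Φ t p D (gT 0 (gxA c) κ Φ t p D) (fT 0 fxA κ Φ t p D)) x du j 3 r (Mu D) z
      (fun i => if i = 0 then kF₀A κ Φ t p D c 0 (gT 0 (gxA c) κ Φ t p D) (fT 0 fxA κ Φ t p D) else kF₁A κ Φ t p D c 0 (gT 0 (gxA c) κ Φ t p D) (fT 0 fxA κ Φ t p D))
      (if 0 ≤ vL κ Φ t p D (gT 0 (gxA c) κ Φ t p D) (fT 0 fxA κ Φ t p D) then sgOf du else -sgOf du) (BFt κ Φ t p D c 0 (gT 0 (gxA c) κ Φ t p D) (fT 0 fxA κ Φ t p D) (if 0 ≤ vL κ Φ t p D (gT 0 (gxA c) κ Φ t p D) (fT 0 fxA κ Φ t p D) then sgOf du else -sgOf du)) (RA' κ Φ t p D 0) (qBF κ Φ t p D c 0 (gT 0 (gxA c) κ Φ t p D) (fT 0 fxA κ Φ t p D)) (RA' κ Φ t p D 0) (qB3YA κ Φ t p D (gT 0 (gxA c) κ Φ t p D) (fT 0 fxA κ Φ t p D) (RA' κ Φ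 t p D 0))
      (yLFt κ Φ t p D c 0 (gT 0 (gxA c) κ Φ t p D) (fT 0 fxA κ Φ t p D) (sgOf du) (if 0 ≤ vL κ Φ t p D (gT 0 (gxA c) κ Φ t p D) (fT 0 fxA κ Φ t p D) then sgOf du else -sgOf du)) (NrY κ Φ t p D (gT 0 (gxA c) κ Φ t p D) (fT 0 fxA κ Φ t p D) (yLFt κ Φ t p D c 0 (gT 0 (gxA c) κ Φ t p D) (fT 0 fxA κ Φ t p D) (sgOf du) (if 0 ≤ vL κ Φ t p D (gT 0 (gxA c) κ Φ t p D) (fT 0 fxA κ Φ t p D) then sgOf du else -sgOf du)) x du z) (N3Y κ Φ t p D (gT 0 (gxA c) κ Φ t p D) (fT 0 fxA κ Φ t p D) (yLFt κ Φ t p D c 0 (gT 0 (gxA c) κ Φ t p D) (fT 0 fxA κ Φ t p D) (sgOf du) (if 0 ≤ vL κ Φ t p D (gT 0 (gxA c) κ Φ t p D) (fT 0 fxA κ Φ t p D) then sgOf du else -sgOf du)) x z) (σTY κ Φ t p D (gT 0 (gxA c) κ Φ t p D) (fT 0 fxA κ Φ t p D) (yLFt κ Φ t p D c 0 (gT 0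 (gxA c) κ Φ t p D) (fT 0 fxA κ Φ t p D) (sgOf du) (if 0 ≤ vL κ Φ t p D (gT 0 (gxA c) κ Φ t p D) (fT 0 fxA κ Φ t p D) then sgOf du else -sgOf du)) x z) := by
  intro x du j z hd hj hlev1 hlev2 hz
  obtain ⟨i, sδ⟩ := du
  change i = 1 at hd
  subst hd
  obtain ⟨hσh, hlo, hhi⟩ := hopY_facts κ Φ t p D (gT 0 (gxA c) κ Φ t p D) (fT 0 fxA κ Φ t p D) ((1 : Fin 2), sδ)
  obtain ⟨hnA, hℓA, hS, hS64, hs0, hs1, hkF0, hkF1, hEu, hE2, hkE, hkE8, hkE24⟩ := floorsY2_hyps_A κ Φ t p D c hN hκ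
  have hcN := (rangesY_YFt κ Φ t p D c 0 (gxA c) fxA hN hκ hS x ((1 : Fin 2), sδ) rfl j hj z hlev1 hlev2 hz hEu hkE _ hσh).1
  exact floorsY2_YFt_A κ Φ t p D c hN hκ x ((1 : Fin 2), sδ) rfl j hj z hlev1 hlev2 hz _ hσh hlo hhi (hcN.trans hc) htop hℓb r hr

end KS

end NegB

end PlanarSkeletonNeg

end Summit.CriticalPhenomena.PercolationContinuityZ3.Theorems.Transplant

end
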